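import Literature.NumberTheory.Sieve.SmoothEndgameMinorCount
import Literature.NumberTheory.Sieve.SmoothEndgameCircle
import Literature.NumberTheory.Sieve.SmoothEndgamePoints
import Literature.NumberTheory.Sieve.SmoothRestriction
import Mathlib.Analysis.MeanInequalities
import HarnessLib

/-!
# The endgame for smooth `a + b = c`: minor points, the model off the centre, the cover

Topic `Literature/NumberTheory/Sieve`; a PROVED file toward
`Literature.NumberTheory.DiophantineGeometry.XYZUpperHalf` ([Harper2016, Cor. 1], §5 with the
smooth weight `w(v) = v²(1−v)²`), on the discrete circle `r/N₀`, `N₀ = ⌊x⌋`: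

* `minor_sum_le`: on the minor points (no `a/q`, `q ≤ Λ/2`, within `Λ/(2x)`), Hölder with exponents
  `(5/4, 5)`, the restriction estimate `discreteRestriction_five_halves` for `S₁ = S_w(·; x/2)` and
  `S₃ = S_w(·; x)` and the minor-arc bound `norm_smoothWeightSum_le_of_minor_count` give
  `∑_{r minor} ‖S₁‖²‖S₃‖ ≤ C (log x)^{19} 𝓟^{5/2} · (sup_minor ‖S₃‖)^{1/2}`;
* `model_noncentral_sum_le`: off the central points the models are small,
  `∑_{r not central} ‖M₁‖² ‖M₃‖ ≤ 10 𝓜₁² 𝓜/Λ` (`‖M(θ)‖ ≤ 5𝓜/(2x‖θ‖)` and Parseval);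
* `sum_noncentral_le_arcs_add_minor`: every non-central point is minor or on a reduced arc
  `a/q`, `2 ≤ q ≤ Λ/2` (`exists_coprime_approx`), as an inequality of sums of a non-negative `f`.

## References

* A. J. Harper, Compositio Math. 152 (2016), Theorems 1–2 and §5 [Harper2016].
-/

noncomputable section

open Finset Real Complex
open scoped FourierTransform Classical

namespace Literature.NumberTheory.Sieve

namespace Endgame

open Vinogradov

/-! ### The model off the central points -/

set_option maxHeartbeats 800000 in
/-- **The models off the centre.** For `x ≥ 2`, `0 ≤ α ≤ 1`, `𝓜 ≥ 0`, `Λ > 0`, `N₀ = ⌊x⌋`: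
`∑_{r not central} ‖M₁(r/N₀)‖² ‖M₃(r/N₀)‖ ≤ 10 𝓜₁² 𝓜/Λ` (`M₃ = M_{𝓜,x,α}`, `M₁ = M_{𝓜₁,x/2,α}`,
central meaning `r x/N₀ ≤ Λ/2` or `(N₀−r)x/N₀ ≤ Λ/2`). [cite: Harper2016, §5] -/
theorem model_noncentral_sum_le {x α M M₁ Λ : ℝ} (hx : 2 ≤ x) (hα : 0 ≤ α) (hα1 : α ≤ 1) (hM : 0 ≤ M) (hM₁ : 0 ≤ M₁)
    (hΛ : 0 < Λ) :
    (∑ r ∈ (Finset.range ⌊x⌋₊).filter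
        (fun r : ℕ => ¬ ((r : ℝ) * x / ⌊x⌋₊ ≤ Λ / 2 ∨ ((⌊x⌋₊ : ℝ) - r) * x / ⌊x⌋₊ ≤ Λ / 2)),
      ‖modelSum M₁ (x / 2) α ((r : ℝ) / ⌊x⌋₊)‖ ^ 2 * ‖modelSum M x α ((r : ℝ) / ⌊x⌋₊)‖) ≤
      10 * (M₁ ^ 2 * M) / Λ := by
  have hx0 : 0 < x := by linarith
  set N₀ : ℕ := ⌊x⌋₊ with hN₀
  have hN₀1 : 1 ≤ N₀ := Nat.le_floor (by simpa using (show (1 : ℝ) ≤ x by linarith))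
  have hN₀x : (N₀ : ℝ) ≤ x := Nat.floor_le hx0.le
  have hN₀0 : (0 : ℝ) < N₀ := by exact_mod_cast hN₀1
  -- the supremum of `‖M₃‖` off the centre
  have hsup : ∀ r ∈ (Finset.range N₀).filter
      (fun r : ℕ => ¬ ((r : ℝ) * x / N₀ ≤ Λ / 2 ∨ ((N₀ : ℝ) - r) * x / N₀ ≤ Λ / 2)),
      ‖modelSum M x α ((r : ℝ) / N₀)‖ ≤ 5 * M / Λ := by
    intro r hr
    obtain ⟨-, hnc⟩ := Finset.mem_filter.mp hr
    push Not at hnc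
    obtain ⟨h1, h2⟩ := hnc
    set θ : ℝ := (r : ℝ) / N₀ with hθ
    have hd : Λ / 2 / x < distInt θ := by
      refine lt_of_lt_of_le ?_ (min_le_distInt θ)
      rw [lt_min_iff, hθ]
      constructor
      · rw [div_lt_iff₀ hx0]
        calc Λ / 2 < (r : ℝ) * x / N₀ := h1
          _ = (r : ℝ) / N₀ * x := by ring
      · rw [div_lt_iff₀ hx0]
        calc Λ / 2 < ((N₀ : ℝ) - r) * x / N₀ := h2
          _ = (1 - (r : ℝ) / N₀) * x := by field_simp
    have hdpos : 0 < distInt θ := lt_trans (by positivity) hd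
    have hx1 : (1 : ℝ) ≤ x := by linarith
    have h := norm_modelSum_mul_distInt_le hM hx1 hα hα1 θ
    -- `‖M‖ ≤ 5M/(x · 2 distInt) < 5M/(x Λ/x) = 5M/Λ`
    have h2d : 2 * (Λ / 2 / x) ≤ 2 * distInt θ := by linarith
    have hpos : 0 < 2 * (Λ / 2 / x) := by positivity
    calc ‖modelSum M x α θ‖ = ‖modelSum M x α θ‖ * (2 * distInt θ) / (2 * distInt θ) := by
          field_simp
      _ ≤ (5 * M / x) / (2 * distInt θ) := div_le_div_of_nonneg_right h (by positivity)
      _ ≤ (5 * M / x) / (2 * (Λ / 2 / x)) := div_le_div_of_nonneg_left (by positivity) hpos h2d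
      _ = 5 * M / Λ := by field_simp
  -- Parseval for `M₁`
  have hpar : ∑ r ∈ Finset.range N₀, ‖modelSum M₁ (x / 2) α ((r : ℝ) / N₀)‖ ^ 2 ≤ N₀ * (M₁ ^ 2 / (x / 2)) :=
    sum_norm_modelSum_sq_le hM₁ (by linarith) hα (Nat.floor_le_floor (by linarith))
  calc _ ≤ ∑ r ∈ (Finset.range N₀).filter
        (fun r : ℕ => ¬ ((r : ℝ) * x / N₀ ≤ Λ / 2 ∨ ((N₀ : ℝ) - r) * x / N₀ ≤ Λ / 2)),
          ‖modelSum M₁ (x / 2) α ((r : ℝ) / N₀)‖ ^ 2 * (5 * M / Λ) := by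
        refine Finset.sum_le_sum fun r hr => ?_
        exact mul_le_mul_of_nonneg_left (hsup r hr) (by positivity)
    _ ≤ ∑ r ∈ Finset.range N₀, ‖modelSum M₁ (x / 2) α ((r : ℝ) / N₀)‖ ^ 2 * (5 * M / Λ) :=
        Finset.sum_le_sum_of_subset_of_nonneg (Finset.filter_subset _ _) fun r _ _ => by positivity
    _ = (∑ r ∈ Finset.range N₀, ‖modelSum M₁ (x / 2) α ((r : ℝ) / N₀)‖ ^ 2) * (5 * M / Λ) := by rw [Finset.sum_mul]
    _ ≤ (N₀ * (M₁ ^ 2 / (x / 2))) * (5 * M / Λ) := mul_le_mul_of_nonneg_right hpar (by positivity)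
    _ = (N₀ / x) * (10 * (M₁ ^ 2 * M) / Λ) := by field_simp; ring
    _ ≤ 1 * (10 * (M₁ ^ 2 * M) / Λ) := by
        apply mul_le_mul_of_nonneg_right _ (by positivity)
        rw [div_le_one hx0]; exact hN₀x
    _ = _ := one_mul _

/-! ### The cover of the non-central points -/

/-- **Non-central points are minor or on a reduced arc.** For `f ≥ 0`, `Λ ≥ 2`, `(Λ/2)² < x`,
`N₀ = ⌊x⌋ ≥ 1`:
`∑_{r not central} f(r) ≤ ∑_{2≤q≤Λ/2} ∑_{(a,q)=1} ∑_{|r/N₀ − a/q| ≤ Λ/(2x)} f(r) + ∑_{r minor} f(r)`.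
[cite: Harper2016, §5] -/
theorem sum_noncentral_le_arcs_add_minor {x Λ : ℝ} (hx : 1 ≤ x) (hΛ : 2 ≤ Λ) (hΛx : (Λ / 2) ^ 2 < x)
    (f : ℕ → ℝ) (hf : ∀ r, 0 ≤ f r) :
    (∑ r ∈ (Finset.range ⌊x⌋₊).filter
        (fun r : ℕ => ¬ ((r : ℝ) * x / ⌊x⌋₊ ≤ Λ / 2 ∨ ((⌊x⌋₊ : ℝ) - r) * x / ⌊x⌋₊ ≤ Λ / 2)), f r) ≤
      (∑ q ∈ Finset.Icc 2 ⌊Λ / 2⌋₊, ∑ a ∈ (Finset.range q).filter (fun a : ℕ => q.Coprime a),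
        ∑ r ∈ (Finset.range ⌊x⌋₊).filter (fun r : ℕ => |(r : ℝ) / ⌊x⌋₊ - (a : ℝ) / q| ≤ Λ / 2 / x), f r) +
      ∑ r ∈ (Finset.range ⌊x⌋₊).filter (fun r : ℕ => ∀ q : ℕ, 1 ≤ q → (q : ℝ) ≤ Λ / 2 →
          ∀ a : ℤ, Λ / 2 / x < |(r : ℝ) / ⌊x⌋₊ - a / q|), f r := by
  have hx0 : 0 < x := by linarith
  set N₀ : ℕ := ⌊x⌋₊ with hN₀
  have hN₀1 : 1 ≤ N₀ := Nat.le_floor (by simpa using hx)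
  have hN₀0 : (0 : ℝ) < N₀ := by exact_mod_cast hN₀1
  set Q : ℝ := Λ / 2 with hQ
  have hQ1 : 1 ≤ Q := by rw [hQ]; linarith
  -- indicator form of every filtered sum
  set ARC : ℕ → ℕ → ℕ → Prop := fun q a r => |(r : ℝ) / N₀ - (a : ℝ) / q| ≤ Q / x with hARC
  set MIN : ℕ → Prop := fun r => ∀ q : ℕ, 1 ≤ q → (q : ℝ) ≤ Q → ∀ a : ℤ, Q / x < |(r : ℝ) / N₀ - a / q| with hMIN
  set CEN : ℕ → Prop := fun r => (r : ℝ) * x / N₀ ≤ Q ∨ ((N₀ : ℝ) - r) * x / N₀ ≤ Q with hCEN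
  -- pointwise domination
  have hpt : ∀ r ∈ Finset.range N₀,
      (if ¬ CEN r then f r else 0) ≤
        (∑ q ∈ Finset.Icc 2 ⌊Q⌋₊, ∑ a ∈ (Finset.range q).filter (fun a : ℕ => q.Coprime a),
          if ARC q a r then f r else 0) + (if MIN r then f r else 0) := by
    intro r hr
    have hrN : r < N₀ := Finset.mem_range.mp hr
    have hS0 : 0 ≤ ∑ q ∈ Finset.Icc 2 ⌊Q⌋₊, ∑ a ∈ (Finset.range q).filter (fun a : ℕ => q.Coprime a),
        if ARC q a r then f r else 0 :=
      Finset.sum_nonneg fun q _ => Finset.sum_nonneg fun a _ => by split_ifs <;> [exact hf r; exact le_rfl]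
    have hM0 : 0 ≤ (if MIN r then f r else 0) := by split_ifs <;> [exact hf r; exact le_rfl]
    by_cases hc : CEN r
    · rw [if_neg (not_not_intro hc)]; positivity
    rw [if_pos hc]
    by_cases hm : MIN r
    · rw [if_pos hm]; linarith
    · -- a rational approximation exists; reduce it
      rw [if_neg hm, add_zero]
      simp only [hMIN, not_forall, not_lt, exists_prop] at hm
      obtain ⟨q, hq1, hqQ, a, happ⟩ := hm
      have hθ0 : 0 ≤ (r : ℝ) / N₀ := by positivity
      have hθ1 : (r : ℝ) / N₀ < 1 := by rw [div_lt_one hN₀0]; exact_mod_cast hrN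
      rcases exists_coprime_approx hQ1 hΛx hθ0 hθ1 hq1 hqQ happ with hleft | hright | ⟨q', hq'2, hq'Q, a', ha'1, ha'q, hcop, harc⟩
      · exfalso; apply hc; left
        have := mul_le_mul_of_nonneg_right hleft hx0.le
        rw [div_mul_cancel₀ _ hx0.ne'] at this
        calc (r : ℝ) * x / N₀ = (r : ℝ) / N₀ * x := by ring
          _ ≤ Q := this
      · exfalso; apply hc; right
        have := mul_le_mul_of_nonneg_right hright hx0.le
        rw [div_mul_cancel₀ _ hx0.ne'] at this
        calc ((N₀ : ℝ) - r) * x / N₀ = (1 - (r : ℝ) / N₀) * x := by field_simp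
          _ ≤ Q := this
      · have hq'mem : q' ∈ Finset.Icc 2 ⌊Q⌋₊ := Finset.mem_Icc.mpr ⟨hq'2, Nat.le_floor hq'Q⟩
        have ha'mem : a' ∈ (Finset.range q').filter (fun a : ℕ => q'.Coprime a) :=
          Finset.mem_filter.mpr ⟨Finset.mem_range.mpr ha'q, Nat.coprime_comm.mp hcop⟩
        have harc' : ARC q' a' r := harc
        calc f r = (if ARC q' a' r then f r else 0) := by rw [if_pos harc']
          _ ≤ ∑ a ∈ (Finset.range q').filter (fun a : ℕ => q'.Coprime a), if ARC q' a r then f r else 0 :=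
              Finset.single_le_sum (f := fun a => if ARC q' a r then f r else 0)
                (fun a _ => by split_ifs <;> [exact hf r; exact le_rfl]) ha'mem
          _ ≤ ∑ q ∈ Finset.Icc 2 ⌊Q⌋₊, ∑ a ∈ (Finset.range q).filter (fun a : ℕ => q.Coprime a),
                if ARC q a r then f r else 0 :=
              Finset.single_le_sum (f := fun q => ∑ a ∈ (Finset.range q).filter (fun a : ℕ => q.Coprime a),
                if ARC q a r then f r else 0)
                (fun q _ => Finset.sum_nonneg fun a _ => by split_ifs <;> [exact hf r; exact le_rfl]) hq'mem
  -- sum the pointwise domination over `r`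
  have hsum := Finset.sum_le_sum hpt
  rw [Finset.sum_add_distrib, ← Finset.sum_filter, ← Finset.sum_filter] at hsum
  refine hsum.trans (add_le_add (le_of_eq ?_) le_rfl)
  -- swap the sums
  rw [Finset.sum_comm]
  refine Finset.sum_congr rfl fun q _ => ?_
  rw [Finset.sum_comm]
  refine Finset.sum_congr rfl fun a _ => ?_
  rw [Finset.sum_filter]


/-! ### The minor points: Hölder, restriction and the minor-arc bound -/

/-- `(a²)^{5/4} = a^{5/2}` and `(√a)^5 = a^{5/2}` for `a ≥ 0`. [folklore] -/
theorem sq_rpow_five_fourths {a : ℝ} (ha : 0 ≤ a) : (a ^ 2) ^ (5 / 4 : ℝ) = a ^ (5 / 2 : ℝ) := by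
  rw [show a ^ 2 = a ^ (2 : ℝ) by rw [← Real.rpow_natCast a 2]; norm_num, ← Real.rpow_mul ha]; norm_num

/-- `(√a)^5 = a^{5/2}` for `a ≥ 0`. [folklore] -/
theorem sqrt_rpow_five {a : ℝ} (ha : 0 ≤ a) : (Real.sqrt a) ^ (5 : ℝ) = a ^ (5 / 2 : ℝ) := by
  rw [Real.sqrt_eq_rpow, ← Real.rpow_mul ha]; norm_num

set_option maxHeartbeats 1600000 in
/-- **The minor points.** For `x ≥ x₀`, `(log x)^8 ≤ y`, `log y ≤ ½(log x)^{1/6}`, `y^{200} ≤ x`,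
`1 − 10⁻⁴ ≤ α(x,y)`, `x^{39999/40000} ≤ Ψ(x,y)`, `2 ≤ Λ`, `Λ/2 ≤ x^{1/10}`, with `N₀ = ⌊x⌋`,
`S₁ = S_w(·; x/2)`, `S₃ = S_w(·; x)`:
`∑_{r minor} ‖S₁(r/N₀)‖² ‖S₃(r/N₀)‖ ≤ C (log x)^{19} 𝓟^{5/2} √B`, `B` being the minor-arc bound of
`norm_smoothWeightSum_le_of_minor_count` at `R = Λ/2` (`𝓟 = x^α ζ(α,y)/√φ₂(α,y)`).
[cite: Harper2016, Theorems 1–2, §5] -/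
theorem minor_sum_le :
    ∃ C C' x₀ : ℝ, 0 < C ∧ 0 < C' ∧ ∀ (x : ℝ) (y : ℕ), x₀ ≤ x → Real.log x ^ 8 ≤ y →
      Real.log y ≤ 1 / 2 * Real.log x ^ (1 / 6 : ℝ) → (y : ℝ) ^ 200 ≤ x →
      1 - 1 / 10000 ≤ saddlePoint x y →
      x ^ ((39999 : ℝ) / 40000) ≤ ((Nat.smoothNumbersUpTo ⌊x⌋₊ (y + 1)).card : ℝ) →
      ∀ Λ : ℝ, 2 ≤ Λ → Λ / 2 ≤ x ^ (1 / 10 : ℝ) →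
      (∑ r ∈ (Finset.range ⌊x⌋₊).filter (fun r : ℕ => ∀ q : ℕ, 1 ≤ q → (q : ℝ) ≤ Λ / 2 →
          ∀ a : ℤ, Λ / 2 / x < |(r : ℝ) / ⌊x⌋₊ - a / q|),
        ‖smoothWeightSum (x / 2) y ((r : ℝ) / ⌊x⌋₊)‖ ^ 2 * ‖smoothWeightSum x y ((r : ℝ) / ⌊x⌋₊)‖) ≤
        C * Real.log x ^ (19 : ℕ) * (x ^ saddlePoint x y *
            (smoothZeta (saddlePoint x y) y / Real.sqrt (saddlePhi₂ (saddlePoint x y) y))) ^ ((5 : ℝ) / 2) *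
          Real.sqrt (C' * Real.log x ^ 3 * (y : ℝ) ^ (5 / 2 * (1 - saddlePoint x y)) *
              (Λ / 2) ^ (-(1 / 2 : ℝ) + 3 / 2 * (1 - saddlePoint x y)) *
              (x ^ saddlePoint x y * (smoothZeta (saddlePoint x y) y / Real.sqrt (saddlePhi₂ (saddlePoint x y) y))) +
            164 * (1 + Real.log x) ^ 2 * (y : ℝ) ^ 2 * x ^ (9 / 10 : ℝ) +
            32 * ((Nat.smoothNumbersUpTo ⌊x⌋₊ (y + 1)).card : ℝ) / (Λ / 2) ^ 2 + 1) := by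
  obtain ⟨C_R, x₀R, hC_R, hR⟩ := discreteRestriction_five_halves
  obtain ⟨C_m, x₀m, hC_m, hm⟩ := norm_smoothWeightSum_le_of_minor_count
  refine ⟨C_R, C_m, max (max x₀R x₀m) 2, hC_R, hC_m, fun x y hx hy8 hylog hy200 hα hΨ Λ hΛ2 hΛx => ?_⟩
  have hx₀R : x₀R ≤ x := le_trans ((le_max_left _ _).trans (le_max_left _ _)) hx
  have hx₀m : x₀m ≤ x := le_trans ((le_max_right _ _).trans (le_max_left _ _)) hx
  have hx2 : 2 ≤ x := le_trans (le_max_right _ _) hx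
  have hx0 : 0 < x := by linarith
  set N₀ : ℕ := ⌊x⌋₊ with hN₀
  have hN₀1 : 1 ≤ N₀ := Nat.le_floor (by simpa using (show (1 : ℝ) ≤ x by linarith))
  have hN₀x : (N₀ : ℝ) ≤ x := Nat.floor_le hx0.le
  have hN₀0 : (0 : ℝ) < N₀ := by exact_mod_cast hN₀1
  set α : ℝ := saddlePoint x y with hα'
  set P : ℝ := x ^ α * (smoothZeta α y / Real.sqrt (saddlePhi₂ α y)) with hP
  -- `y ≥ 2` (else `α(x,y) = 0`), `α > 0`, `𝓟 > 0`
  have hy2 : 2 ≤ y := by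
    by_contra hlt
    push Not at hlt
    have h0 : α = 0 := by
      rw [hα', saddlePoint, dif_neg (fun h => absurd h.2 (by omega))]
    rw [h0] at hα; norm_num at hα
  have hα0 : 0 < α := saddlePoint_pos (by linarith) hy2
  have hζ : 0 < smoothZeta α y := smoothZeta_pos hα0
  have hφ₂ : 0 < saddlePhi₂ α y := saddlePhi₂_pos hy2 hα0
  have hP0 : 0 < P := by rw [hP]; positivity
  have hy1 : (1 : ℝ) ≤ y := by exact_mod_cast (show 1 ≤ y by omega)
  have hy80 : (y : ℝ) ^ 80 ≤ x := le_trans (pow_le_pow_right₀ hy1 (by norm_num)) hy200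
  have hR1 : 1 ≤ Λ / 2 := by linarith
  -- ### the two weighted sums as sums over `S(x, y)` with bounded coefficients
  set S₃ : ℕ → ℂ := fun r => smoothWeightSum x y ((r : ℝ) / N₀) with hS₃
  set S₁ : ℕ → ℂ := fun r => smoothWeightSum (x / 2) y ((r : ℝ) / N₀) with hS₁
  set a₃ : ℕ → ℂ := fun n => if (n : ℝ) ≤ x then ((wt ((n : ℝ) / x) : ℝ) : ℂ) else 0 with ha₃
  set a₁ : ℕ → ℂ := fun n => if n ≤ ⌊x / 2⌋₊ then ((wt ((n : ℝ) / (x / 2)) : ℝ) : ℂ) else 0 with ha₁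
  have ha₃b : ∀ n, ‖a₃ n‖ ≤ 1 := by
    intro n; simp only [ha₃]
    split_ifs with hn
    · rw [Complex.norm_real, Real.norm_eq_abs, abs_of_nonneg (wt_nonneg _)]
      exact wt_le_one (by positivity) (by rw [div_le_one hx0]; exact hn)
    · simp
  have ha₁b : ∀ n, ‖a₁ n‖ ≤ 1 := by
    intro n; simp only [ha₁]
    split_ifs with hn
    · rw [Complex.norm_real, Real.norm_eq_abs, abs_of_nonneg (wt_nonneg _)]
      refine wt_le_one (by positivity) ?_
      rw [div_le_one (by positivity)]
      exact le_trans (by exact_mod_cast hn) (Nat.floor_le (by positivity))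
    · simp
  have hS₃eq : ∀ r : ℕ, ∑ n ∈ Nat.smoothNumbersUpTo ⌊x⌋₊ (y + 1), a₃ n * (𝐞 ((n : ℝ) * ((r : ℝ) / N₀)) : ℂ) = S₃ r := by
    intro r
    simp only [hS₃, smoothWeightSum]
    refine Finset.sum_congr rfl fun n hn => ?_
    have hnx : (n : ℝ) ≤ x := le_trans (by exact_mod_cast (Nat.mem_smoothNumbersUpTo.mp hn).1) hN₀x
    simp only [ha₃, if_pos hnx]
  have hS₁eq : ∀ r : ℕ, ∑ n ∈ Nat.smoothNumbersUpTo ⌊x⌋₊ (y + 1), a₁ n * (𝐞 ((n : ℝ) * ((r : ℝ) / N₀)) : ℂ) = S₁ r := by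
    intro r
    simp only [hS₁, smoothWeightSum]
    have hsub : Nat.smoothNumbersUpTo ⌊x / 2⌋₊ (y + 1) ⊆ Nat.smoothNumbersUpTo ⌊x⌋₊ (y + 1) :=
      smoothNumbersUpTo_mono_left (Nat.floor_le_floor (by linarith)) _
    rw [← Finset.sum_subset hsub]
    · refine Finset.sum_congr rfl fun n hn => ?_
      have hnx : n ≤ ⌊x / 2⌋₊ := (Nat.mem_smoothNumbersUpTo.mp hn).1
      simp only [ha₁, if_pos hnx]
    · intro n hn hn'
      have hgt : ¬ n ≤ ⌊x / 2⌋₊ := by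
        intro hle
        exact hn' (Nat.mem_smoothNumbersUpTo.mpr ⟨hle, (Nat.mem_smoothNumbersUpTo.mp hn).2⟩)
      simp only [ha₁, if_neg hgt, zero_mul]
  -- ### restriction estimates
  set B : ℝ := C_R * Real.log x ^ (19 : ℕ) * P ^ ((5 : ℝ) / 2) with hB
  have hlogx : 0 < Real.log x := Real.log_pos (by linarith)
  have hB0 : 0 < B := by rw [hB]; positivity
  have hR₃ : ∑ r ∈ Finset.range N₀, ‖S₃ r‖ ^ ((5 : ℝ) / 2) ≤ B := by
    have h := hR x y hx₀R hy8 hylog hy200 hα hΨ N₀ hN₀1 hN₀x a₃ ha₃b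
    simp_rw [hS₃eq] at h
    simpa [hB, hP] using h
  have hR₁ : ∑ r ∈ Finset.range N₀, ‖S₁ r‖ ^ ((5 : ℝ) / 2) ≤ B := by
    have h := hR x y hx₀R hy8 hylog hy200 hα hΨ N₀ hN₀1 hN₀x a₁ ha₁b
    simp_rw [hS₁eq] at h
    simpa [hB, hP] using h
  -- ### Hölder with exponents `5/4` and `5`
  have hpq : Real.HolderConjugate (5 / 4 : ℝ) 5 := ⟨by norm_num, by norm_num, by norm_num⟩
  have hHolder := Real.inner_le_Lp_mul_Lq_of_nonneg (Finset.range N₀) hpq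
    (f := fun r => ‖S₁ r‖ ^ 2) (g := fun r => Real.sqrt ‖S₃ r‖) (fun r _ => by positivity) (fun r _ => Real.sqrt_nonneg _)
  have hf : ∑ r ∈ Finset.range N₀, (‖S₁ r‖ ^ 2) ^ (5 / 4 : ℝ) = ∑ r ∈ Finset.range N₀, ‖S₁ r‖ ^ ((5 : ℝ) / 2) :=
    Finset.sum_congr rfl fun r _ => sq_rpow_five_fourths (norm_nonneg _)
  have hg : ∑ r ∈ Finset.range N₀, (Real.sqrt ‖S₃ r‖) ^ (5 : ℝ) = ∑ r ∈ Finset.range N₀, ‖S₃ r‖ ^ ((5 : ℝ) / 2) :=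
    Finset.sum_congr rfl fun r _ => sqrt_rpow_five (norm_nonneg _)
  rw [hf, hg] at hHolder
  have hinner : ∑ r ∈ Finset.range N₀, ‖S₁ r‖ ^ 2 * Real.sqrt ‖S₃ r‖ ≤ B := by
    refine hHolder.trans ?_
    have h1 : (∑ r ∈ Finset.range N₀, ‖S₁ r‖ ^ ((5 : ℝ) / 2)) ^ (1 / (5 / 4 : ℝ)) ≤ B ^ (4 / 5 : ℝ) := by
      rw [show (1 / (5 / 4 : ℝ)) = 4 / 5 by norm_num]
      exact Real.rpow_le_rpow (Finset.sum_nonneg fun r _ => by positivity) hR₁ (by norm_num)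
    have h2 : (∑ r ∈ Finset.range N₀, ‖S₃ r‖ ^ ((5 : ℝ) / 2)) ^ (1 / (5 : ℝ)) ≤ B ^ (1 / 5 : ℝ) :=
      Real.rpow_le_rpow (Finset.sum_nonneg fun r _ => by positivity) hR₃ (by norm_num)
    calc _ ≤ B ^ (4 / 5 : ℝ) * B ^ (1 / 5 : ℝ) :=
          mul_le_mul h1 h2 (Real.rpow_nonneg (Finset.sum_nonneg fun r _ => by positivity) _) (Real.rpow_nonneg hB0.le _)
      _ = B := by rw [← Real.rpow_add hB0]; norm_num
  -- ### the minor-arc supremum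
  set Bsup : ℝ := C_m * Real.log x ^ 3 * (y : ℝ) ^ (5 / 2 * (1 - α)) * (Λ / 2) ^ (-(1 / 2 : ℝ) + 3 / 2 * (1 - α)) * P +
      164 * (1 + Real.log x) ^ 2 * (y : ℝ) ^ 2 * x ^ (9 / 10 : ℝ) +
      32 * ((Nat.smoothNumbersUpTo ⌊x⌋₊ (y + 1)).card : ℝ) / (Λ / 2) ^ 2 + 1 with hBsup
  have hBsup0 : 0 ≤ Bsup := by rw [hBsup]; positivity
  have hsup : ∀ r ∈ (Finset.range N₀).filter (fun r : ℕ => ∀ q : ℕ, 1 ≤ q → (q : ℝ) ≤ Λ / 2 →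
      ∀ a : ℤ, Λ / 2 / x < |(r : ℝ) / N₀ - a / q|), ‖S₃ r‖ ≤ Bsup := by
    intro r hr
    obtain ⟨-, hmin⟩ := Finset.mem_filter.mp hr
    have h := hm x y hx₀m hy8 hylog hy80 x (by linarith) le_rfl (Λ / 2) hR1 hΛx ((r : ℝ) / N₀) hmin
    simpa [hS₃, hBsup, hP] using h
  -- ### assemble
  calc (∑ r ∈ (Finset.range N₀).filter (fun r : ℕ => ∀ q : ℕ, 1 ≤ q → (q : ℝ) ≤ Λ / 2 →
          ∀ a : ℤ, Λ / 2 / x < |(r : ℝ) / N₀ - a / q|), ‖S₁ r‖ ^ 2 * ‖S₃ r‖)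
      ≤ ∑ r ∈ (Finset.range N₀).filter (fun r : ℕ => ∀ q : ℕ, 1 ≤ q → (q : ℝ) ≤ Λ / 2 →
          ∀ a : ℤ, Λ / 2 / x < |(r : ℝ) / N₀ - a / q|), ‖S₁ r‖ ^ 2 * Real.sqrt ‖S₃ r‖ * Real.sqrt Bsup := by
        refine Finset.sum_le_sum fun r hr => ?_
        have h2 : Real.sqrt ‖S₃ r‖ ≤ Real.sqrt Bsup := Real.sqrt_le_sqrt (hsup r hr)
        calc ‖S₁ r‖ ^ 2 * ‖S₃ r‖ = ‖S₁ r‖ ^ 2 * (Real.sqrt ‖S₃ r‖ * Real.sqrt ‖S₃ r‖) := by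
              rw [Real.mul_self_sqrt (norm_nonneg _)]
          _ = ‖S₁ r‖ ^ 2 * Real.sqrt ‖S₃ r‖ * Real.sqrt ‖S₃ r‖ := by ring
          _ ≤ ‖S₁ r‖ ^ 2 * Real.sqrt ‖S₃ r‖ * Real.sqrt Bsup := mul_le_mul_of_nonneg_left h2 (by positivity)
    _ = (∑ r ∈ (Finset.range N₀).filter (fun r : ℕ => ∀ q : ℕ, 1 ≤ q → (q : ℝ) ≤ Λ / 2 →
          ∀ a : ℤ, Λ / 2 / x < |(r : ℝ) / N₀ - a / q|), ‖S₁ r‖ ^ 2 * Real.sqrt ‖S₃ r‖) * Real.sqrt Bsup := by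
        rw [Finset.sum_mul]
    _ ≤ (∑ r ∈ Finset.range N₀, ‖S₁ r‖ ^ 2 * Real.sqrt ‖S₃ r‖) * Real.sqrt Bsup := by
        apply mul_le_mul_of_nonneg_right _ (Real.sqrt_nonneg _)
        exact Finset.sum_le_sum_of_subset_of_nonneg (Finset.filter_subset _ _) fun r _ _ => by positivity
    _ ≤ B * Real.sqrt Bsup := mul_le_mul_of_nonneg_right hinner (Real.sqrt_nonneg _)
    _ = _ := by rw [hB]

end Endgame

end Literature.NumberTheory.Sieve

end
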